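import Literature.MathematicalPhysics.QuantumFieldTheory.Balaban1983to89.B9Eq342SupNormDecayFromBlockDecay

/-!
# `Balaban1983to89.B9Eq342SupNormDecayFromBlockDecayStencil` — T. Bałaban, *Propagators for lattice gauge theories in a background field*, Commun. Math.
# Phys. **99** (1985) 389–434 [Balaban1985BackgroundPropagators] Thm 3.1 (3.42) p. 397 ∕ Thm 3.3 (3.47) p. 398 (the value rows WITH the decay factor
# `B₀e^{−δ₀d(y,y′)}`), (3.26) p. 395 (the local part `A₀ = Δ(U) + D_UD*_U + Q*aQ`), (3.69) p. 404 («the supremum … is taken over bonds belonging to one of the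
# plaquettes containing the bond b»), with [Balaban1985Variational] (134)–(136) p. 298: **THE DECAYED VALUE ROW FROM THE LETTERS WITH TWO MORE SLOTS — a
# finite block STENCIL in the block-local penalty and an `L^∞` (pointwise, finite-range) zeroth-order perturbation closed by a contraction on the
# decay-weighted supremum** — the abstract twin of ne9-leaf-06's `B9Eq342SupNormDecayFromBlockDecay.norm_apply_le_decay_of_letters` that the BOND local part
# needs (its `K = Δ′ − η⁻²𝒦` is pointwise `O(α)`, not block-`L²`; print's vector averaging `Q_k` reads two blocks), typed for road ΔA-CT's answer W-1 to
# beta-an4's INTERFACE REQUEST D4 (journal [NE9LEAF03-G78-W1]; OFFER O-leaf03-g78-1 (WKP))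

statement-level skeleton of published theorems with citation tags; proofs where landed; nothing here is a claim about the Yang–Mills mass gap

CITATION HEADER (lean-in-tree rule).  Audit cell `pub-balaban`, sub-cell `t4`, BINDER row NE9; filed by NE9 crux-team LEAF PROVER 03
(`b2b-balaban-t4-ne9-formalise-leaf-03`, gen 78; road ΔA-CT).  Imports ne9-leaf-06's `B9Eq342SupNormDecayFromBlockDecay` (`block_apply_eq_self_of_support`,
`sqrt_bracket_le`; through it `B9Eq342BlockDecayWeightedSum` and ne9-leaf-02's `B9Eq342SupNormBootstrapWeightedChain`).  Sources READ first-hand in the held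
text (`paper:balaban1985-cmp99-background-propagators`, journal page = PDF page + 388): p. 397 Thm 3.1 (3.42), p. 398 Thm 3.3 (3.47), p. 395 (3.26), p. 404
(3.69); [Balaban1985Variational] p. 298 (134)–(136).  Print proves its rows by the random walk of Sect. C; NOTHING of it is reproduced; the cell's road is Kato
domination + a supersolution weight + the chain's `L²` block decay; every statement below is [folklore] bookkeeping over DISPLAYED letters.

WHAT IS PROVED (sorry-free; proof lane — 0 `def`; [folklore]).  Abstract carrier `X` (`L²`-weight `w > 0`), blocks `π : X → Y` with the (K1) family `P`,
pseudo-metric `δ` (nonneg, triangle); weighted graph `nbr`∕`ω ≥ 0`, contractive transporters `T`, mass `m₀ > 0`.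
* §1 `exp_decay_le_weight`, `exp_decay_shift_le` — the two triangle-inequality letters (a decay factor from the source block read against a weight centred
  at the output block; a stencil shift costs `e^{κs}`).
* §2 **`data_le_weight_stencil`** — the weighted data letter with a STENCIL penalty `‖q(x)‖ ≤ p₂·Σ_{i∈I₂}‖P_{st(x,i)}u‖ + p_∞·M_x` for EVERY local sup bound
  `M_x` of `u` on the sites `near x` (`δ(πx, st(x,i)) ≤ s₂`, `near x x′ ⟹ δ(πx, πx′) ≤ s₁`) and an A-PRIORI decayed bound `‖u(x)‖ ≤ N·e^{−aδ(πx,v)}`: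
  `‖f y‖ + ‖q y‖ ≤ M·e^{−aδ(πx₀,v)}·(F + p₂·|I₂|e^{κs₂}·C + p_∞·e^{as₁}·N)∕λ·(λW y)`.
* §3 **`norm_apply_le_decay_apriori`** — the bootstrap at one centre: `‖u(x₀)‖ ≤ (A·F + θ·N)·e^{−aδ(πx₀,v)}` with
  `A = M(1 + p₂|I₂|e^{κs₂}C_E√μ)∕λ·Σ_{l<k}(m₀∕λ)^l + m₀^k·C₃·C_E·√(MS)·√μ`, `θ = M·p_∞·e^{as₁}∕λ·Σ_{l<k}(m₀∕λ)^l`.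
* §4 **`norm_apply_le_decay_of_letters_stencil`** — with a weight FAMILY (one supersolution weight centred at every site) and the decayed free letter at every
  centre: `θ < 1` ⟹ `‖u(x₀)‖ ≤ A∕(1 − θ)·e^{−aδ(πx₀,v)}·F` at EVERY `x₀` (the maximiser of `‖u(x)‖e^{aδ(πx,v)}` on the finite carrier closes the contraction).
HONEST SCOPE.  Abstract composition; no instance (the tower local part `A₀,k` on the bond graph of `towerP` is the next file (EA0S)); VALUE row only; `B₀`
crude; «NE9 ⇐ the named binders»; NE9 NOT PRINTED ∕ NOT PROVED; row WALLED ON A MODEL (O-NE9-1; #5 UNRULED); spine PROVED 0∕9; rung (B)+1 on a finite T⁴ —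
NOT infinite volume, NOT mass gap, NOT BetaPertH, NOT Clay.  HONEST DEPENDENCY: continuum YM on T⁴ ⇐ BetaPertH ∧ nine spine estimates (0/9 proved); BetaPertH
⇐ (D1) ∧ (D4) ∧ CAP+tail; G-an2-4 gates asym, D1 and NE2/3/4.  NEW file; nothing modified.  Net new unproved facts: 0.
-/

noncomputable section

open scoped BigOperators

namespace Literature.MathematicalPhysics.QuantumFieldTheory.Balaban1983to89.B9Eq342SupNormDecayFromBlockDecayStencil

open B9Eq311L2Pairing (WL2)
open B9Eq342BlockDecayWeightedSum (norm_block_apply_le_of_block_decay norm_apply_le_weight_of_support)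
open B9Eq342SupNormBootstrapWeightedChain (exists_scalar_chain norm_le_of_kato_bootstrap_weighted_chain_centre)
open B9Eq342SupNormDecayFromBlockDecay (block_apply_eq_self_of_support sqrt_bracket_le)

section Blocks

variable {𝕜 : Type*} [RCLike 𝕜] {X Y : Type*} [Fintype X] [Fintype Y] [DecidableEq Y] {w : X → ℝ} [Fact (∀ x, 0 < w x)]
  {V : Type*} [NormedAddCommGroup V] [InnerProductSpace 𝕜 V]
  {π : X → Y} {P : Y → WL2 𝕜 w V →L[𝕜] WL2 𝕜 w V}
  (hP : ∀ (y : Y) (f : WL2 𝕜 w V) (x : X), WL2.equiv 𝕜 w V (P y f) x = if π x = y then WL2.equiv 𝕜 w V f x else 0)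
  {δ : Y → Y → ℝ} (hδ0 : ∀ y y', 0 ≤ δ y y') (hδt : ∀ u y v, δ u v ≤ δ u y + δ y v)

/-! ## §1 Two triangle-inequality letters -/

include hδt in
omit [Fintype X] [Fintype Y] [DecidableEq Y] in
/-- **A DECAY FACTOR FROM THE SOURCE BLOCK AGAINST A WEIGHT CENTRED AT THE OUTPUT BLOCK**: `e^{aδ(u,πx)} ≤ M·W(x)` (`0 ≤ a`, `0 ≤ M`, `0 ≤ W`) ⟹
`e^{−aδ(πx,v)} ≤ M·e^{−aδ(u,v)}·W(x)`. [folklore] [cite: Balaban1985BackgroundPropagators, Thm 3.1 (3.42) p.397, (3.49) p.399] -/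
theorem exp_decay_le_weight (u v : Y) {W : X → ℝ} {M a : ℝ} (ha : 0 ≤ a)
    (hWa : ∀ x, Real.exp (a * δ u (π x)) ≤ M * W x) (x : X) :
    Real.exp (-(a * δ (π x) v)) ≤ M * Real.exp (-(a * δ u v)) * W x := by
  have h1 : Real.exp (-(a * δ (π x) v)) ≤ Real.exp (-(a * δ u v)) * Real.exp (a * δ u (π x)) := by
    rw [← Real.exp_add]
    apply Real.exp_le_exp.mpr
    have h3 : a * δ u v ≤ a * (δ u (π x) + δ (π x) v) := mul_le_mul_of_nonneg_left (hδt u (π x) v) ha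
    linarith
  calc Real.exp (-(a * δ (π x) v)) ≤ Real.exp (-(a * δ u v)) * Real.exp (a * δ u (π x)) := h1
    _ ≤ Real.exp (-(a * δ u v)) * (M * W x) := mul_le_mul_of_nonneg_left (hWa x) (Real.exp_pos _).le
    _ = M * Real.exp (-(a * δ u v)) * W x := by ring

include hδt in
omit [Fintype Y] [DecidableEq Y] in
/-- **A STENCIL SHIFT COSTS `e^{κs}`**: `δ(y,σ) ≤ s`, `0 ≤ κ` ⟹ `e^{−κδ(σ,v)} ≤ e^{κs}·e^{−κδ(y,v)}`. [folklore]
[cite: Balaban1985BackgroundPropagators, (3.69) p.404, (3.49) p.399] -/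
theorem exp_decay_shift_le {κ s : ℝ} (hκ : 0 ≤ κ) {y σ : Y} (hs : δ y σ ≤ s) (v : Y) :
    Real.exp (-(κ * δ σ v)) ≤ Real.exp (κ * s) * Real.exp (-(κ * δ y v)) := by
  rw [← Real.exp_add]
  apply Real.exp_le_exp.mpr
  have h1 : κ * δ y v ≤ κ * (δ y σ + δ σ v) := mul_le_mul_of_nonneg_left (hδt y σ v) hκ
  have h2 : κ * δ y σ ≤ κ * s := mul_le_mul_of_nonneg_left hs hκ
  linarith

/-! ## §2 The weighted data letter with a stencil penalty and an `L^∞` slot -/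

include hδ0 hδt in
omit [Fintype Y] [DecidableEq Y] in
/-- **THE WEIGHTED DATA LETTER, STENCIL + `L^∞` SLOT.**  A source `f` supported in the block `v` with `‖f(x)‖ ≤ F`; a zeroth-order remainder
`‖q(x)‖ ≤ p₂·Σ_{i∈I₂}‖P_{st(x,i)}u‖ + p_∞·M_x` for EVERY `M_x ≥ 0` bounding `‖u(x′)‖` on the sites `near x` (a RELATION; print's (3.69): the bonds of
the plaquettes containing `b`), whose stencil stays within `δ(πx, st(x,i)) ≤ s₂` and whose near sites within `δ(πx, πx′) ≤ s₁`; the block decay `‖P_y u‖ ≤ C·e^{−κδ(y,v)}`; an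
A-PRIORI decayed bound `‖u(x)‖ ≤ N·e^{−aδ(πx,v)}` (`0 ≤ a ≤ κ`); a weight `W > 0` with `e^{κ₁δ(πx₀,πx)} ≤ M·W(x)`, `a ≤ κ₁`.  Then for every `λ > 0`
`‖f y‖ + ‖q y‖ ≤ M·e^{−aδ(πx₀,v)}·(F + p₂·(|I₂|e^{κs₂}C) + p_∞·(e^{as₁}N))∕λ·(λW y)`. [folklore]
[cite: Balaban1985BackgroundPropagators, Thm 3.1 (3.42) p.397, (3.26) p.395, (3.69) p.404, (3.49) p.399; Balaban1985Variational, (134)–(136) p.298] -/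
theorem data_le_weight_stencil {f u : WL2 𝕜 w V} {v : Y} (hfv : ∀ x, π x ≠ v → WL2.equiv 𝕜 w V f x = 0)
    {F : ℝ} (hF0 : 0 ≤ F) (hF : ∀ x, ‖WL2.equiv 𝕜 w V f x‖ ≤ F)
    {I₂ : Type*} [Fintype I₂] (near : X → X → Prop) (st : X → I₂ → Y) {s₁ s₂ : ℝ}
    (hnear : ∀ x x', near x x' → δ (π x) (π x') ≤ s₁) (hst : ∀ x i, δ (π x) (st x i) ≤ s₂)
    {q : X → V} {p₂ pinf : ℝ} (hp₂ : 0 ≤ p₂)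
    (hq : ∀ (x : X) (Mx : ℝ), 0 ≤ Mx → (∀ x', near x x' → ‖WL2.equiv 𝕜 w V u x'‖ ≤ Mx) →
      ‖q x‖ ≤ p₂ * ∑ i, ‖P (st x i) u‖ + pinf * Mx)
    {C κ : ℝ} (hC : 0 ≤ C) (hblk : ∀ y, ‖P y u‖ ≤ C * Real.exp (-(κ * δ y v)))
    {N a : ℝ} (hN : 0 ≤ N) (ha : 0 ≤ a) (haκ : a ≤ κ) (hapr : ∀ x, ‖WL2.equiv 𝕜 w V u x‖ ≤ N * Real.exp (-(a * δ (π x) v)))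
    (x₀ : X) {W : X → ℝ} (hW0 : ∀ x, 0 < W x) {M κ₁ : ℝ} (hM : 0 ≤ M) (hW : ∀ x, Real.exp (κ₁ * δ (π x₀) (π x)) ≤ M * W x)
    (haκ₁ : a ≤ κ₁) {lam : ℝ} (hlam : 0 < lam) (y : X) :
    ‖WL2.equiv 𝕜 w V f y‖ + ‖q y‖ ≤
      M * Real.exp (-(a * δ (π x₀) v)) *
        (F + p₂ * (Fintype.card I₂ * Real.exp (κ * s₂) * C) + pinf * (Real.exp (a * s₁) * N)) / lam * (lam * W y) := by
  set E : ℝ := Real.exp (-(a * δ (π x₀) v)) with hE_def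
  have hκ0 : 0 ≤ κ := ha.trans haκ
  -- the weight dominates the slower exponential too
  have hWa : ∀ x, Real.exp (a * δ (π x₀) (π x)) ≤ M * W x := fun x =>
    (Real.exp_le_exp.2 (mul_le_mul_of_nonneg_right haκ₁ (hδ0 _ _))).trans (hW x)
  -- the decay factor from `v` at any site against the weight centred at `π x₀`
  have hEW : ∀ x, Real.exp (-(a * δ (π x) v)) ≤ M * E * W x := fun x => exp_decay_le_weight hδt (π x₀) v ha hWa x
  -- the source
  have h1 : ‖WL2.equiv 𝕜 w V f y‖ ≤ F * M * E * W y :=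
    norm_apply_le_weight_of_support hfv hF0 hF (π x₀) (fun x => (hW0 x).le) hM hWa y
  -- the stencil blocks
  have h2 : ∀ i, ‖P (st y i) u‖ ≤ Real.exp (κ * s₂) * C * (M * E * W y) := by
    intro i
    have hκa : Real.exp (-(κ * δ (π y) v)) ≤ Real.exp (-(a * δ (π y) v)) :=
      Real.exp_le_exp.2 (by nlinarith [hδ0 (π y) v])
    calc ‖P (st y i) u‖ ≤ C * Real.exp (-(κ * δ (st y i) v)) := hblk _
      _ ≤ C * (Real.exp (κ * s₂) * Real.exp (-(κ * δ (π y) v))) :=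
          mul_le_mul_of_nonneg_left (exp_decay_shift_le hδt hκ0 (hst y i) v) hC
      _ ≤ C * (Real.exp (κ * s₂) * (M * E * W y)) :=
          mul_le_mul_of_nonneg_left (mul_le_mul_of_nonneg_left (hκa.trans (hEW y)) (Real.exp_pos _).le) hC
      _ = Real.exp (κ * s₂) * C * (M * E * W y) := by ring
  have h2s : ∑ i, ‖P (st y i) u‖ ≤ Fintype.card I₂ * Real.exp (κ * s₂) * C * (M * E * W y) := by
    calc ∑ i, ‖P (st y i) u‖ ≤ ∑ _i : I₂, Real.exp (κ * s₂) * C * (M * E * W y) := Finset.sum_le_sum fun i _ => h2 i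
      _ = Fintype.card I₂ * Real.exp (κ * s₂) * C * (M * E * W y) := by
          rw [Finset.sum_const, Finset.card_univ, nsmul_eq_mul]; ring
  -- the pointwise part through the a-priori decayed bound: a local sup at `y`, decaying from `v`
  have h3 : ∀ x', near y x' → ‖WL2.equiv 𝕜 w V u x'‖ ≤ Real.exp (a * s₁) * N * (M * E * W y) := by
    intro x' hx'
    calc ‖WL2.equiv 𝕜 w V u x'‖ ≤ N * Real.exp (-(a * δ (π x') v)) := hapr _
      _ ≤ N * (Real.exp (a * s₁) * Real.exp (-(a * δ (π y) v))) :=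
          mul_le_mul_of_nonneg_left (exp_decay_shift_le hδt ha (hnear y x' hx') v) hN
      _ ≤ N * (Real.exp (a * s₁) * (M * E * W y)) :=
          mul_le_mul_of_nonneg_left (mul_le_mul_of_nonneg_left (hEW y) (Real.exp_pos _).le) hN
      _ = Real.exp (a * s₁) * N * (M * E * W y) := by ring
  have hMy : 0 ≤ Real.exp (a * s₁) * N * (M * E * W y) := by have := hW0 y; positivity
  have hq' : ‖q y‖ ≤ p₂ * (Fintype.card I₂ * Real.exp (κ * s₂) * C * (M * E * W y)) +
      pinf * (Real.exp (a * s₁) * N * (M * E * W y)) :=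
    (hq y _ hMy h3).trans (add_le_add (mul_le_mul_of_nonneg_left h2s hp₂) le_rfl)
  have e : M * E * (F + p₂ * (Fintype.card I₂ * Real.exp (κ * s₂) * C) + pinf * (Real.exp (a * s₁) * N)) / lam *
        (lam * W y) =
      F * M * E * W y + (p₂ * (Fintype.card I₂ * Real.exp (κ * s₂) * C * (M * E * W y)) +
        pinf * (Real.exp (a * s₁) * N * (M * E * W y))) := by
    rw [div_mul_eq_mul_div, mul_div_assoc, mul_div_cancel_left₀ _ hlam.ne']
    ring
  rw [e]
  exact add_le_add h1 hq'

/-! ## §3 The bootstrap at one centre with the a-priori term -/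

include hP hδ0 hδt in
/-- **THE DECAYED VALUE ROW AT ONE CENTRE, A-PRIORI FORM.**  As ne9-leaf-06's `norm_apply_le_decay_of_letters` (supersolution weight `λW ≤ (L₀+m₀)W`
centred at `x₀`, `W x₀ = 1`, `e^{κ₁δ(πx₀,πx)} ≤ M·W x`; block decay `‖P_y∘G∘P_v‖ ≤ C_E e^{−κδ(y,v)}`; source in `v`, `‖f(x)‖ ≤ F`, `‖f‖ ≤ √μ·F`; the
`k`-chain free letter `C₃` at `x₀`; rates `0 ≤ a ≤ κ`, `a ≤ κ₁`, `Σ_{y′}e^{−(κ₁−2a)δ(y,y′)} ≤ S`) but with the STENCIL penalty and the `L^∞` slot of §2 and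
an a-priori decayed bound `‖u(x)‖ ≤ N·e^{−aδ(πx,v)}`:
`‖u(x₀)‖ ≤ ((M(1 + p₂|I₂|e^{κs₂}C_E√μ)∕λ·Σ_{l<k}(m₀∕λ)^l + m₀^k·C₃·C_E·√(MS)·√μ)·F + (M·p_∞e^{as₁}∕λ·Σ_{l<k}(m₀∕λ)^l)·N)·e^{−aδ(πx₀,v)}`.
[folklore] [cite: Balaban1985BackgroundPropagators, Thm 3.1 (3.42) p.397, Thm 3.3 (3.47) p.398, (3.26) p.395, (3.69) p.404, (3.49) p.399;
Balaban1985Variational, (134)–(136) p.298] -/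
theorem norm_apply_le_decay_apriori {J : Type*} [Fintype J] (nbr : X → J → X) (ω : X → J → ℝ) (hω : ∀ x j, 0 ≤ ω x j)
    (T : X → J → V →ₗ[𝕜] V) (hT : ∀ x j z, ‖T x j z‖ ≤ ‖z‖) {m₀ : ℝ} (hm₀ : 0 < m₀)
    {W : X → ℝ} (hW0 : ∀ x, 0 < W x) {lam : ℝ} (hlam : 0 < lam)
    (hsup : ∀ x, lam * W x ≤ ∑ j, ω x j * (W x - W (nbr x j)) + m₀ * W x) {x₀ : X} (hx₀ : W x₀ = 1)
    {M κ₁ : ℝ} (hM : 0 ≤ M) (hW : ∀ x, Real.exp (κ₁ * δ (π x₀) (π x)) ≤ M * W x)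
    (G : WL2 𝕜 w V →L[𝕜] WL2 𝕜 w V) {f : WL2 𝕜 w V} {v : Y} (hfv : ∀ x, π x ≠ v → WL2.equiv 𝕜 w V f x = 0)
    {F : ℝ} (hF0 : 0 ≤ F) (hF : ∀ x, ‖WL2.equiv 𝕜 w V f x‖ ≤ F) {μ : ℝ} (hμ : ‖f‖ ≤ Real.sqrt μ * F)
    {CE κ : ℝ} (hCE : 0 ≤ CE) (hdec : ∀ y, ‖P y ∘L G ∘L P v‖ ≤ CE * Real.exp (-(κ * δ y v)))
    {I₂ : Type*} [Fintype I₂] (near : X → X → Prop) (st : X → I₂ → Y) {s₁ s₂ : ℝ}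
    (hnear : ∀ x x', near x x' → δ (π x) (π x') ≤ s₁) (hst : ∀ x i, δ (π x) (st x i) ≤ s₂)
    {q : X → V} (hu : ∀ x, ∑ j, (ω x j : 𝕜) • (WL2.equiv 𝕜 w V (G f) x - T x j (WL2.equiv 𝕜 w V (G f) (nbr x j))) =
      WL2.equiv 𝕜 w V f x - q x)
    {p₂ pinf : ℝ} (hp₂ : 0 ≤ p₂) (hpinf : 0 ≤ pinf)
    (hq : ∀ (x : X) (Mx : ℝ), 0 ≤ Mx → (∀ x', near x x' → ‖WL2.equiv 𝕜 w V (G f) x'‖ ≤ Mx) →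
      ‖q x‖ ≤ p₂ * ∑ i, ‖P (st x i) (G f)‖ + pinf * Mx)
    {N : ℝ} (hN : 0 ≤ N) {a : ℝ} (ha : 0 ≤ a) (haκ : a ≤ κ) (haκ₁ : a ≤ κ₁)
    (hapr : ∀ x, ‖WL2.equiv 𝕜 w V (G f) x‖ ≤ N * Real.exp (-(a * δ (π x) v)))
    {k : ℕ} {C₃ : ℝ} (hC₃ : 0 ≤ C₃)
    (hFS : ∀ φ : ℕ → X → ℝ, (∀ y, 0 ≤ φ 0 y) →
      (∀ j < k, ∀ x, ∑ i, ω x i * (φ (j + 1) x - φ (j + 1) (nbr x i)) + m₀ * φ (j + 1) x = φ j x) →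
      φ k x₀ ≤ C₃ * Real.sqrt (∑ y, w y * φ 0 y ^ 2 / W y))
    {S : ℝ} (hS : ∀ y, ∑ y', Real.exp (-((κ₁ - 2 * a) * δ y y')) ≤ S) :
    ‖WL2.equiv 𝕜 w V (G f) x₀‖ ≤
      ((M * (1 + p₂ * (Fintype.card I₂ * Real.exp (κ * s₂)) * CE * Real.sqrt μ) / lam * ∑ l ∈ Finset.range k, (m₀ / lam) ^ l +
          m₀ ^ k * C₃ * CE * Real.sqrt (M * S) * Real.sqrt μ) * F +
        (M * (pinf * Real.exp (a * s₁)) / lam * ∑ l ∈ Finset.range k, (m₀ / lam) ^ l) * N) *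
        Real.exp (-(a * δ (π x₀) v)) := by
  set u : X → V := WL2.equiv 𝕜 w V (G f) with hu_def
  set E : ℝ := Real.exp (-(a * δ (π x₀) v)) with hE_def
  have hE0 : 0 < E := Real.exp_pos _
  -- the source is its own block component; block decay of the solution
  have hfP : P v f = f := block_apply_eq_self_of_support hP hfv
  have hblk : ∀ y, ‖P y (G f)‖ ≤ CE * ‖f‖ * Real.exp (-(κ * δ y v)) := fun y =>
    calc ‖P y (G f)‖ ≤ CE * Real.exp (-(κ * δ y v)) * ‖f‖ := norm_block_apply_le_of_block_decay (δ := δ) G hfP hdec y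
      _ = CE * ‖f‖ * Real.exp (-(κ * δ y v)) := by ring
  -- the weighted data letter (§2) with `C := C_E‖f‖`
  set s : ℝ := M * E * (F + p₂ * (Fintype.card I₂ * Real.exp (κ * s₂) * (CE * ‖f‖)) +
      pinf * (Real.exp (a * s₁) * N)) / lam with hs_def
  have hs : 0 ≤ s := by positivity
  have hdata : ∀ y, ‖WL2.equiv 𝕜 w V f y‖ + ‖q y‖ ≤ s * (lam * W y) :=
    data_le_weight_stencil (P := P) hδ0 hδt hfv hF0 hF near st hnear hst hp₂ hq (by positivity) hblk hN ha haκ hapr x₀ hW0 hM hW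
      haκ₁ hlam
  -- the `k`-chain of the solution and the weighted bootstrap at the centre
  obtain ⟨φ, hφ0, hφ⟩ := exists_scalar_chain nbr ω hω hm₀ (fun y => ‖u y‖) k
  have hφ0' : ∀ y, φ 0 y = ‖u y‖ := fun y => by rw [hφ0]
  have hWK := norm_le_of_kato_bootstrap_weighted_chain_centre nbr ω hω T hT hm₀ hlam hsup hu hs hdata hφ0' hφ hx₀
  -- the free value by the decayed free letter and the (D-E) bracket
  have hφk : φ k x₀ ≤ C₃ * Real.sqrt (∑ y, w y * ‖u y‖ ^ 2 / W y) := by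
    have h := hFS φ (fun y => by rw [hφ0']; exact norm_nonneg _) hφ
    simpa only [hφ0'] using h
  have hbr : Real.sqrt (∑ y, w y * ‖u y‖ ^ 2 / W y) ≤ Real.sqrt (M * S) * CE * ‖f‖ * E :=
    sqrt_bracket_le hP hδ0 hδt G hfP hCE hdec x₀ hW0 hM hW ha haκ hS
  -- `‖f‖ ≤ √μ·F`
  have hMS : 0 ≤ Real.sqrt (M * S) := Real.sqrt_nonneg _
  have hsum0 : 0 ≤ ∑ l ∈ Finset.range k, (m₀ / lam) ^ l := Finset.sum_nonneg fun l _ => by positivity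
  have hA : s ≤ M * E * (F + p₂ * (Fintype.card I₂ * Real.exp (κ * s₂) * (CE * (Real.sqrt μ * F))) +
      pinf * (Real.exp (a * s₁) * N)) / lam := by
    rw [hs_def]
    gcongr
  have hB : φ k x₀ ≤ C₃ * (Real.sqrt (M * S) * CE * (Real.sqrt μ * F) * E) := by
    refine hφk.trans (mul_le_mul_of_nonneg_left (hbr.trans ?_) hC₃)
    gcongr
  calc ‖u x₀‖ ≤ s * ∑ l ∈ Finset.range k, (m₀ / lam) ^ l + m₀ ^ k * φ k x₀ := hWK
    _ ≤ M * E * (F + p₂ * (Fintype.card I₂ * Real.exp (κ * s₂) * (CE * (Real.sqrt μ * F))) +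
            pinf * (Real.exp (a * s₁) * N)) / lam * ∑ l ∈ Finset.range k, (m₀ / lam) ^ l +
          m₀ ^ k * (C₃ * (Real.sqrt (M * S) * CE * (Real.sqrt μ * F) * E)) :=
        add_le_add (mul_le_mul_of_nonneg_right hA hsum0) (mul_le_mul_of_nonneg_left hB (pow_nonneg hm₀.le k))
    _ = ((M * (1 + p₂ * (Fintype.card I₂ * Real.exp (κ * s₂)) * CE * Real.sqrt μ) / lam * ∑ l ∈ Finset.range k, (m₀ / lam) ^ l +
            m₀ ^ k * C₃ * CE * Real.sqrt (M * S) * Real.sqrt μ) * F +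
          (M * (pinf * Real.exp (a * s₁)) / lam * ∑ l ∈ Finset.range k, (m₀ / lam) ^ l) * N) * E := by
        ring

/-! ## §4 The contraction on the decay-weighted supremum: the decayed row at every centre -/

include hP hδ0 hδt in
/-- **THE DECAYED VALUE ROW FROM THE LETTERS — STENCIL PENALTY, `L^∞` SLOT, EVERY CENTRE.**  Carrier, blocks, graph, transporters, mass as in §3; a
WEIGHT FAMILY `W x₀` (for every centre `x₀`: `0 < W x₀`, `λ·W x₀ ≤ (L₀+m₀)(W x₀)`, `W x₀ x₀ = 1`, `e^{κ₁δ(πx₀,πx)} ≤ M·W x₀ x`); the block decay of `G`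
from the source block `v`; the source (`‖f(x)‖ ≤ F`, `‖f‖ ≤ √μ·F`); the covariant equation for `u = Gf` with the remainder `q` in the STENCIL + `L^∞`
form `‖q(x)‖ ≤ p₂·Σ_{i∈I₂}‖P_{st(x,i)}u‖ + p_∞·M_x` (every local sup bound `M_x` on `near x`); the decayed free letter `C₃` at EVERY centre; rates
`0 ≤ a ≤ κ`, `a ≤ κ₁`, `Σ_{y′}e^{−(κ₁−2a)δ(y,y′)} ≤ S`; and the CONTRACTION LETTER `θ := M·p_∞·e^{as₁}∕λ·Σ_{l<k}(m₀∕λ)^l < 1`.  THEN at every centre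
`‖u(x₀)‖ ≤ A∕(1 − θ)·e^{−aδ(πx₀,v)}·F`, `A = M(1 + p₂|I₂|e^{κs₂}C_E√μ)∕λ·Σ_{l<k}(m₀∕λ)^l + m₀^k·C₃·C_E·√(MS)·√μ` — print's
«|(Gλ)(x)| ≤ B₀e^{−δ₀d(y,y′)}|λ|, supp λ ⊂ Δ(y′)» SHAPE for an operator whose zeroth-order part has a pointwise `O(p_∞)` piece (the local part `A₀`'s
`K = Δ′ − η⁻²𝒦`), every letter displayed. [folklore] [cite: Balaban1985BackgroundPropagators, Thm 3.1 (3.42) p.397, Thm 3.3 (3.47) p.398, (3.26) p.395,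
(3.69) p.404, (3.49) p.399; Balaban1985Variational, (134)–(136) p.298] -/
theorem norm_apply_le_decay_of_letters_stencil {J : Type*} [Fintype J] (nbr : X → J → X) (ω : X → J → ℝ) (hω : ∀ x j, 0 ≤ ω x j)
    (T : X → J → V →ₗ[𝕜] V) (hT : ∀ x j z, ‖T x j z‖ ≤ ‖z‖) {m₀ : ℝ} (hm₀ : 0 < m₀)
    {W : X → X → ℝ} (hW0 : ∀ x₀ x, 0 < W x₀ x) {lam : ℝ} (hlam : 0 < lam)
    (hsup : ∀ x₀ x, lam * W x₀ x ≤ ∑ j, ω x j * (W x₀ x - W x₀ (nbr x j)) + m₀ * W x₀ x) (hx₀ : ∀ x₀, W x₀ x₀ = 1)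
    {M κ₁ : ℝ} (hM : 0 ≤ M) (hW : ∀ x₀ x, Real.exp (κ₁ * δ (π x₀) (π x)) ≤ M * W x₀ x)
    (G : WL2 𝕜 w V →L[𝕜] WL2 𝕜 w V) {f : WL2 𝕜 w V} {v : Y} (hfv : ∀ x, π x ≠ v → WL2.equiv 𝕜 w V f x = 0)
    {F : ℝ} (hF0 : 0 ≤ F) (hF : ∀ x, ‖WL2.equiv 𝕜 w V f x‖ ≤ F) {μ : ℝ} (hμ : ‖f‖ ≤ Real.sqrt μ * F)
    {CE κ : ℝ} (hCE : 0 ≤ CE) (hdec : ∀ y, ‖P y ∘L G ∘L P v‖ ≤ CE * Real.exp (-(κ * δ y v)))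
    {I₂ : Type*} [Fintype I₂] (near : X → X → Prop) (st : X → I₂ → Y) {s₁ s₂ : ℝ}
    (hnear : ∀ x x', near x x' → δ (π x) (π x') ≤ s₁) (hst : ∀ x i, δ (π x) (st x i) ≤ s₂)
    {q : X → V} (hu : ∀ x, ∑ j, (ω x j : 𝕜) • (WL2.equiv 𝕜 w V (G f) x - T x j (WL2.equiv 𝕜 w V (G f) (nbr x j))) =
      WL2.equiv 𝕜 w V f x - q x)
    {p₂ pinf : ℝ} (hp₂ : 0 ≤ p₂) (hpinf : 0 ≤ pinf)
    (hq : ∀ (x : X) (Mx : ℝ), 0 ≤ Mx → (∀ x', near x x' → ‖WL2.equiv 𝕜 w V (G f) x'‖ ≤ Mx) →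
      ‖q x‖ ≤ p₂ * ∑ i, ‖P (st x i) (G f)‖ + pinf * Mx)
    {a : ℝ} (ha : 0 ≤ a) (haκ : a ≤ κ) (haκ₁ : a ≤ κ₁)
    {k : ℕ} {C₃ : ℝ} (hC₃ : 0 ≤ C₃)
    (hFS : ∀ (x₀ : X) (φ : ℕ → X → ℝ), (∀ y, 0 ≤ φ 0 y) →
      (∀ j < k, ∀ x, ∑ i, ω x i * (φ (j + 1) x - φ (j + 1) (nbr x i)) + m₀ * φ (j + 1) x = φ j x) →
      φ k x₀ ≤ C₃ * Real.sqrt (∑ y, w y * φ 0 y ^ 2 / W x₀ y))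
    {S : ℝ} (hS : ∀ y, ∑ y', Real.exp (-((κ₁ - 2 * a) * δ y y')) ≤ S)
    (hθ : M * (pinf * Real.exp (a * s₁)) / lam * ∑ l ∈ Finset.range k, (m₀ / lam) ^ l < 1) (x₀ : X) :
    ‖WL2.equiv 𝕜 w V (G f) x₀‖ ≤
      (M * (1 + p₂ * (Fintype.card I₂ * Real.exp (κ * s₂)) * CE * Real.sqrt μ) / lam * ∑ l ∈ Finset.range k, (m₀ / lam) ^ l +
          m₀ ^ k * C₃ * CE * Real.sqrt (M * S) * Real.sqrt μ) /
        (1 - M * (pinf * Real.exp (a * s₁)) / lam * ∑ l ∈ Finset.range k, (m₀ / lam) ^ l) *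
        Real.exp (-(a * δ (π x₀) v)) * F := by
  set u : X → V := WL2.equiv 𝕜 w V (G f) with hu_def
  set A : ℝ := M * (1 + p₂ * (Fintype.card I₂ * Real.exp (κ * s₂)) * CE * Real.sqrt μ) / lam * ∑ l ∈ Finset.range k, (m₀ / lam) ^ l +
      m₀ ^ k * C₃ * CE * Real.sqrt (M * S) * Real.sqrt μ with hA_def
  set θ : ℝ := M * (pinf * Real.exp (a * s₁)) / lam * ∑ l ∈ Finset.range k, (m₀ / lam) ^ l with hθ_def
  -- the decay-weighted supremum `N` is attained on the finite carrier
  let g : X → ℝ := fun x => ‖u x‖ * Real.exp (a * δ (π x) v)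
  obtain ⟨xs, -, hxs⟩ := Finset.exists_max_image Finset.univ g ⟨x₀, Finset.mem_univ _⟩
  set N : ℝ := g xs with hN_def
  have hN0 : 0 ≤ N := mul_nonneg (norm_nonneg _) (Real.exp_pos _).le
  have hapr : ∀ x, ‖u x‖ ≤ N * Real.exp (-(a * δ (π x) v)) := by
    intro x
    have hgx : g x ≤ N := hxs x (Finset.mem_univ _)
    have he : Real.exp (a * δ (π x) v) * Real.exp (-(a * δ (π x) v)) = 1 := by
      rw [← Real.exp_add, add_neg_cancel, Real.exp_zero]
    calc ‖u x‖ = g x * Real.exp (-(a * δ (π x) v)) := by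
          show ‖u x‖ = ‖u x‖ * Real.exp (a * δ (π x) v) * Real.exp (-(a * δ (π x) v))
          rw [mul_assoc, he, mul_one]
      _ ≤ N * Real.exp (-(a * δ (π x) v)) := mul_le_mul_of_nonneg_right hgx (Real.exp_pos _).le
  -- §3 at the maximiser: `N ≤ A·F + θ·N`
  have hmax := norm_apply_le_decay_apriori hP hδ0 hδt nbr ω hω T hT hm₀ (hW0 xs) hlam (hsup xs) (hx₀ xs) hM (hW xs) G hfv hF0 hF hμ hCE
    hdec near st hnear hst hu hp₂ hpinf hq hN0 ha haκ haκ₁ hapr hC₃ (hFS xs) hS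
  have hNle : N ≤ A * F + θ * N := by
    have he : Real.exp (-(a * δ (π xs) v)) * Real.exp (a * δ (π xs) v) = 1 := by
      rw [← Real.exp_add, neg_add_cancel, Real.exp_zero]
    have h1 : N = ‖u xs‖ * Real.exp (a * δ (π xs) v) := rfl
    rw [h1]
    calc ‖u xs‖ * Real.exp (a * δ (π xs) v) ≤ (A * F + θ * N) * Real.exp (-(a * δ (π xs) v)) * Real.exp (a * δ (π xs) v) :=
          mul_le_mul_of_nonneg_right hmax (Real.exp_pos _).le
      _ = A * F + θ * N := by rw [mul_assoc, he, mul_one]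
  have hθ1 : 0 < 1 - θ := by rw [hθ_def]; linarith
  have hAF : 0 ≤ A * F := by positivity
  have hNle' : N ≤ A / (1 - θ) * F := by
    rw [div_mul_eq_mul_div, le_div_iff₀ hθ1]
    nlinarith
  -- at the given centre
  calc ‖u x₀‖ ≤ N * Real.exp (-(a * δ (π x₀) v)) := hapr x₀
    _ ≤ A / (1 - θ) * F * Real.exp (-(a * δ (π x₀) v)) := mul_le_mul_of_nonneg_right hNle' (Real.exp_pos _).le
    _ = A / (1 - θ) * Real.exp (-(a * δ (π x₀) v)) * F := by ring

end Blocks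

end Literature.MathematicalPhysics.QuantumFieldTheory.Balaban1983to89.B9Eq342SupNormDecayFromBlockDecayStencil

end
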